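import Summits.CriticalPhenomena.CardyFormulaZ2.Theses.CardyMeckeFlip
import Summits.CriticalPhenomena.CardyFormulaZ2.Theorems.CardyMeckeFlipLawToCrossingsFamily
import Literature.Probability.Percolation.QuadCrossingRotationInvarianceOfSS
import Literature.Probability.RandomPlanarGeometry.ModulusSymmetry
import Literature.Probability.RandomPlanarGeometry.ConformalRectangleShift
import Literature.Probability.RandomPlanarGeometry.CardyFunctionIncBeta
import HarnessLib

/-!
# The quad of a conformal rectangle and its transpose in `𝒬_ℂ`; their Cardy values under
# `SublimitsCardy`

Support file for item `LawToCrossings` (stmt-CriticalPhenomena-14828) of route `CardyMeckeFlip`,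
sub-problem `CardyFormulaZ2`.

Let `R` be a conformal rectangle and `Φ : ℂ ≃ₜ ℂ` a square model of `R`
(`exists_isSquareModel`: `Φ` maps the model square `(-1, 1)²` onto `R.carrier` and side `k` of
the square onto `R.arc k`).  With `rotI : z ↦ i z` and `H = (Homeomorph.mulLeft₀ Complex.I Complex.I_ne_zero).trans Φ` (so `H z = Φ (i z)`):

* `rq H a b` is the rectangle `Φ([-b, b] × [-a, a])`, crossed from its bottom side to its top
  side (`carrier_rq_rot`, `side_zero_rq_rot` …); for `a = b = 1` it is THE quad of `R`:
  carrier `closure R.carrier`, sides `R.arc 0, 1, 2, 3` (`carrier_quadOf`, `side_quadOf`);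
* `rq Φ a b` is `Φ([-a, a] × [-b, b])` crossed from left to right; for `a = b = 1` its sides are
  `R.arc 3, 0, 1, 2` — the quad of the conformal rectangle `R` re-marked three steps
  (`exists_shift3`: same carrier, `pt i = R.pt (i + 3)`), whose cross-ratio is `1 - η_R`
  (`crossRatio_shift3`, Möbius renormalisation `exists_isUniformizing_of_cyclic`);
* consequently, for every subsequential limit `μ ∈ Λ` and every uniformizing datum `(φ, x)`
  of `R`, `SublimitsCardy` gives `μ ⊞_{rq H 1 1} = F(η)` and `μ ⊞_{rq Φ 1 1} = 1 - F(η)`,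
  `η = crossRatio x` (`measure_crossedEvent_quadOf`, `measure_crossedEvent_transposeOf`;
  `F(1 - η) = 1 - F(η)` is `cardyFunction_one_sub_holds`).

References: O. Schramm, S. Smirnov, Ann. Probab. 39 (2011), §1.3; J. Cardy, J. Phys. A 25 (1992)
(duality symmetry of `F`); L. V. Ahlfors, *Complex Analysis* (1979), Ch. 3 §3.1 (cross-ratio).
-/

noncomputable section

open Set Filter MeasureTheory Metric Complex
open scoped Topology unitInterval ENNReal
open Literature.Probability.Percolation Literature.Probability.Percolation.QuadCrossing
open Literature.Probability.RandomPlanarGeometry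
open UpperHalfPlane (upperHalfPlaneSet)

namespace Summit.CriticalPhenomena.CardyFormulaZ2.Theorems.MeckeFlipBridge

/-! ### The quarter turn `z ↦ i z` -/

/-- `rotI z = i z` for the quarter turn `rotI = Homeomorph.mulLeft₀ Complex.I Complex.I_ne_zero` (written out in
full below; the docstrings call it `rotI`). -/
theorem rotI_apply (z : ℂ) : Homeomorph.mulLeft₀ Complex.I Complex.I_ne_zero z = Complex.I * z := rfl

/-- The quarter turn maps the rectangle `[-a, a] × [-b, b]` onto `[-b, b] × [-a, a]`. -/
theorem image_rotI_reProdIm (a b : ℝ) :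
    (Homeomorph.mulLeft₀ Complex.I Complex.I_ne_zero : ℂ → ℂ) '' (Icc (-a) a ×ℂ Icc (-b) b) =
      Icc (-b) b ×ℂ Icc (-a) a := by
  ext w
  simp only [mem_image, mem_reProdIm, mem_Icc, rotI_apply]
  constructor
  · rintro ⟨z, ⟨⟨h1, h2⟩, h3, h4⟩, rfl⟩
    have hre : (Complex.I * z).re = -z.im := by simp
    have him : (Complex.I * z).im = z.re := by simp
    rw [hre, him]
    exact ⟨⟨by linarith, by linarith⟩, h1, h2⟩
  · rintro ⟨⟨h1, h2⟩, h3, h4⟩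
    refine ⟨-Complex.I * w, ?_, by rw [← mul_assoc, mul_neg, Complex.I_mul_I, neg_neg, one_mul]⟩
    have hre : (-Complex.I * w).re = w.im := by simp
    have him : (-Complex.I * w).im = -w.re := by simp
    rw [hre, him]
    exact ⟨⟨h3, h4⟩, by linarith, by linarith⟩

/-- The quarter turn maps the vertical segment `{re = c, im ∈ [-b, b]}` onto the horizontal
segment `{im = c, re ∈ [-b, b]}`. -/
theorem image_rotI_re_eq (c b : ℝ) :
    (Homeomorph.mulLeft₀ Complex.I Complex.I_ne_zero : ℂ → ℂ) '' {w : ℂ | w.re = c ∧ w.im ∈ Icc (-b) b} =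
      {w : ℂ | w.im = c ∧ w.re ∈ Icc (-b) b} := by
  ext w
  simp only [mem_image, mem_setOf_eq, mem_Icc, rotI_apply]
  constructor
  · rintro ⟨z, ⟨h1, h3, h4⟩, rfl⟩
    have hre : (Complex.I * z).re = -z.im := by simp
    have him : (Complex.I * z).im = z.re := by simp
    rw [hre, him]
    exact ⟨h1, by linarith, by linarith⟩
  · rintro ⟨h1, h3, h4⟩
    refine ⟨-Complex.I * w, ?_, by rw [← mul_assoc, mul_neg, Complex.I_mul_I, neg_neg, one_mul]⟩
    have hre : (-Complex.I * w).re = w.im := by simp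
    have him : (-Complex.I * w).im = -w.re := by simp
    rw [hre, him]
    exact ⟨h1, by linarith, by linarith⟩

/-- The quarter turn maps the horizontal segment `{im = c, re ∈ [-a, a]}` onto the vertical
segment `{re = -c, im ∈ [-a, a]}`. -/
theorem image_rotI_im_eq (c a : ℝ) :
    (Homeomorph.mulLeft₀ Complex.I Complex.I_ne_zero : ℂ → ℂ) '' {w : ℂ | w.im = c ∧ w.re ∈ Icc (-a) a} =
      {w : ℂ | w.re = -c ∧ w.im ∈ Icc (-a) a} := by
  ext w
  simp only [mem_image, mem_setOf_eq, mem_Icc, rotI_apply]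
  constructor
  · rintro ⟨z, ⟨h1, h3, h4⟩, rfl⟩
    have hre : (Complex.I * z).re = -z.im := by simp
    have him : (Complex.I * z).im = z.re := by simp
    rw [hre, him]
    exact ⟨by rw [h1], h3, h4⟩
  · rintro ⟨h1, h3, h4⟩
    refine ⟨-Complex.I * w, ?_, by rw [← mul_assoc, mul_neg, Complex.I_mul_I, neg_neg, one_mul]⟩
    have hre : (-Complex.I * w).re = w.im := by simp
    have him : (-Complex.I * w).im = -w.re := by simp
    rw [hre, him]
    exact ⟨by rw [h1]; ring, h3, h4⟩

/-! ### The quads `rq ((Homeomorph.mulLeft₀ Complex.I Complex.I_ne_zero).trans Φ) a b` in the coordinates of `Φ` -/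

/-- Carrier of `rq ((Homeomorph.mulLeft₀ Complex.I Complex.I_ne_zero).trans Φ) a b`: the rectangle `Φ([-b, b] × [-a, a])`. -/
theorem carrier_rq_rot (Φ : ℂ ≃ₜ ℂ) {a b : ℝ} (ha : 0 < a) (hb : 0 < b) :
    (Quad.rectQuad ((Homeomorph.mulLeft₀ Complex.I Complex.I_ne_zero).trans Φ) a b ha hb (fun _ => mem_univ _)).carrier = Φ '' (Icc (-b) b ×ℂ Icc (-a) a) := by
  rw [carrier_rq]
  change (⇑Φ ∘ ⇑(Homeomorph.mulLeft₀ Complex.I Complex.I_ne_zero)) '' _ = _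
  rw [image_comp, image_rotI_reProdIm]

/-- Side `0` of `rq ((Homeomorph.mulLeft₀ Complex.I Complex.I_ne_zero).trans Φ) a b`: the bottom side `Φ([-b, b] × {-a})`. -/
theorem side_zero_rq_rot (Φ : ℂ ≃ₜ ℂ) {a b : ℝ} (ha : 0 < a) (hb : 0 < b) :
    (Quad.rectQuad ((Homeomorph.mulLeft₀ Complex.I Complex.I_ne_zero).trans Φ) a b ha hb (fun _ => mem_univ _)).side 0 = Φ '' {w : ℂ | w.im = -a ∧ w.re ∈ Icc (-b) b} := by
  rw [side_zero_rq]
  change (⇑Φ ∘ ⇑(Homeomorph.mulLeft₀ Complex.I Complex.I_ne_zero)) '' _ = _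
  rw [image_comp, image_rotI_re_eq]

/-- Side `2` of `rq ((Homeomorph.mulLeft₀ Complex.I Complex.I_ne_zero).trans Φ) a b`: the top side `Φ([-b, b] × {a})`. -/
theorem side_two_rq_rot (Φ : ℂ ≃ₜ ℂ) {a b : ℝ} (ha : 0 < a) (hb : 0 < b) :
    (Quad.rectQuad ((Homeomorph.mulLeft₀ Complex.I Complex.I_ne_zero).trans Φ) a b ha hb (fun _ => mem_univ _)).side 2 = Φ '' {w : ℂ | w.im = a ∧ w.re ∈ Icc (-b) b} := by
  rw [side_two_rq]
  change (⇑Φ ∘ ⇑(Homeomorph.mulLeft₀ Complex.I Complex.I_ne_zero)) '' _ = _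
  rw [image_comp, image_rotI_re_eq]

/-- Side `1` of `rq ((Homeomorph.mulLeft₀ Complex.I Complex.I_ne_zero).trans Φ) a b`: the right side `Φ({b} × [-a, a])`. -/
theorem side_one_rq_rot (Φ : ℂ ≃ₜ ℂ) {a b : ℝ} (ha : 0 < a) (hb : 0 < b) :
    (Quad.rectQuad ((Homeomorph.mulLeft₀ Complex.I Complex.I_ne_zero).trans Φ) a b ha hb (fun _ => mem_univ _)).side 1 = Φ '' {w : ℂ | w.re = b ∧ w.im ∈ Icc (-a) a} := by
  rw [side_one_rq]
  change (⇑Φ ∘ ⇑(Homeomorph.mulLeft₀ Complex.I Complex.I_ne_zero)) '' _ = _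
  rw [image_comp, image_rotI_im_eq, neg_neg]

/-- Side `3` of `rq ((Homeomorph.mulLeft₀ Complex.I Complex.I_ne_zero).trans Φ) a b`: the left side `Φ({-b} × [-a, a])`. -/
theorem side_three_rq_rot (Φ : ℂ ≃ₜ ℂ) {a b : ℝ} (ha : 0 < a) (hb : 0 < b) :
    (Quad.rectQuad ((Homeomorph.mulLeft₀ Complex.I Complex.I_ne_zero).trans Φ) a b ha hb (fun _ => mem_univ _)).side 3 = Φ '' {w : ℂ | w.re = -b ∧ w.im ∈ Icc (-a) a} := by
  rw [side_three_rq]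
  change (⇑Φ ∘ ⇑(Homeomorph.mulLeft₀ Complex.I Complex.I_ne_zero)) '' _ = _
  rw [image_comp, image_rotI_im_eq]

/-! ### The quad of `R` and its four sides -/

section SquareModel

variable {R : ConformalRectangle} {Φ : ℂ ≃ₜ ℂ} (h : IsSquareModel R Φ)
include h

/-- **The quad of `R`**: for a square model `Φ` of `R`, `rq ((Homeomorph.mulLeft₀ Complex.I Complex.I_ne_zero).trans Φ) 1 1` has carrier the
closed quad `closure R.carrier`. -/
theorem carrier_quadOf : (Quad.rectQuad ((Homeomorph.mulLeft₀ Complex.I Complex.I_ne_zero).trans Φ) 1 1 one_pos one_pos (fun _ => mem_univ _)).carrier = closure R.carrier := by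
  rw [carrier_rq_rot, h.image_Icc]

/-- Side `0` of the quad of `R` is `R.arc 0`. -/
theorem side_zero_quadOf : (Quad.rectQuad ((Homeomorph.mulLeft₀ Complex.I Complex.I_ne_zero).trans Φ) 1 1 one_pos one_pos (fun _ => mem_univ _)).side 0 = R.arc 0 := by
  rw [side_zero_rq_rot, ← h.image_arc 0]
  congr 1
  ext w
  rw [SquareModel.mem_arc_zero]
  rfl

/-- Side `1` of the quad of `R` is `R.arc 1`. -/
theorem side_one_quadOf : (Quad.rectQuad ((Homeomorph.mulLeft₀ Complex.I Complex.I_ne_zero).trans Φ) 1 1 one_pos one_pos (fun _ => mem_univ _)).side 1 = R.arc 1 := by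
  rw [side_one_rq_rot, ← h.image_arc 1]
  congr 1
  ext w
  rw [SquareModel.mem_arc_one]
  rfl

/-- Side `2` of the quad of `R` is `R.arc 2`. -/
theorem side_two_quadOf : (Quad.rectQuad ((Homeomorph.mulLeft₀ Complex.I Complex.I_ne_zero).trans Φ) 1 1 one_pos one_pos (fun _ => mem_univ _)).side 2 = R.arc 2 := by
  rw [side_two_rq_rot, ← h.image_arc 2]
  congr 1
  ext w
  rw [SquareModel.mem_arc_two]
  rfl

/-- Side `3` of the quad of `R` is `R.arc 3`. -/
theorem side_three_quadOf : (Quad.rectQuad ((Homeomorph.mulLeft₀ Complex.I Complex.I_ne_zero).trans Φ) 1 1 one_pos one_pos (fun _ => mem_univ _)).side 3 = R.arc 3 := by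
  rw [side_three_rq_rot, ← h.image_arc 3]
  congr 1
  ext w
  rw [SquareModel.mem_arc_three]
  rfl

/-! ### The transposed quad `rq Φ 1 1` and its four sides -/

/-- The transposed quad `rq Φ 1 1` has carrier `closure R.carrier`. -/
theorem carrier_transposeOf : (Quad.rectQuad (Φ) 1 1 one_pos one_pos (fun _ => mem_univ _)).carrier = closure R.carrier := by
  rw [carrier_rq, h.image_Icc]

/-- Side `0` of the transposed quad is `R.arc 3` (the left side). -/
theorem side_zero_transposeOf : (Quad.rectQuad (Φ) 1 1 one_pos one_pos (fun _ => mem_univ _)).side 0 = R.arc 3 := by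
  rw [side_zero_rq, ← h.image_arc 3]
  congr 1
  ext w
  rw [SquareModel.mem_arc_three]
  rfl

/-- Side `1` of the transposed quad is `R.arc 0` (the bottom side). -/
theorem side_one_transposeOf : (Quad.rectQuad (Φ) 1 1 one_pos one_pos (fun _ => mem_univ _)).side 1 = R.arc 0 := by
  rw [side_one_rq, ← h.image_arc 0]
  congr 1
  ext w
  rw [SquareModel.mem_arc_zero]
  rfl

/-- Side `2` of the transposed quad is `R.arc 1` (the right side). -/
theorem side_two_transposeOf : (Quad.rectQuad (Φ) 1 1 one_pos one_pos (fun _ => mem_univ _)).side 2 = R.arc 1 := by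
  rw [side_two_rq, ← h.image_arc 1]
  congr 1
  ext w
  rw [SquareModel.mem_arc_one]
  rfl

/-- Side `3` of the transposed quad is `R.arc 2` (the top side). -/
theorem side_three_transposeOf : (Quad.rectQuad (Φ) 1 1 one_pos one_pos (fun _ => mem_univ _)).side 3 = R.arc 2 := by
  rw [side_three_rq, ← h.image_arc 2]
  congr 1
  ext w
  rw [SquareModel.mem_arc_two]
  rfl

end SquareModel

/-! ### The conformal rectangle re-marked three steps -/

/-- One cyclic re-marking `(Ω; P₁, P₂, P₃, P₀)` of `R` (`MarkedDomain.exists_shiftMarks`), with its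
marked points and arcs expressed through those of `R`. -/
theorem exists_shift1 (R : ConformalRectangle) : ∃ R' : ConformalRectangle,
    R'.carrier = R.carrier ∧ (∀ i, R'.pt i = R.pt (i + 1)) ∧
    R'.arc 0 = R.arc 1 ∧ R'.arc 1 = R.arc 2 ∧ R'.arc 2 = R.arc 3 ∧ R'.arc 3 = R.arc 0 := by
  obtain ⟨R', hc, hb, hm, h0, h1, h2, h3⟩ := MarkedDomain.exists_shiftMarks R
  refine ⟨R', hc, fun i => ?_, h0, h1, h2, h3⟩
  rw [MarkedDomain.pt, hb, hm]
  fin_cases i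
  · simp [MarkedDomain.pt]
  · simp [MarkedDomain.pt]
  · simp [MarkedDomain.pt]
  · simp only [Fin.reduceFinMk, Matrix.cons_val, Fin.reduceAdd, MarkedDomain.pt]
    rw [show R.mark 0 + 1 - R.mark 1 + R.mark 1 = R.mark 0 + 1 by ring, R.periodic_boundary]

/-- **The re-marked rectangle `(Ω; P₃, P₀, P₁, P₂)`**: same carrier, marked points
`pt i = R.pt (i + 3)`, arcs `R.arc 3, R.arc 0, R.arc 1, R.arc 2`.  Its crossing (arc `0` to arc
`2`, i.e. `R.arc 3` to `R.arc 1`) is the transversal crossing of `R`. -/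
theorem exists_shift3 (R : ConformalRectangle) : ∃ R' : ConformalRectangle,
    R'.carrier = R.carrier ∧ (∀ i, R'.pt i = R.pt (i + 3)) ∧
    R'.arc 0 = R.arc 3 ∧ R'.arc 1 = R.arc 0 ∧ R'.arc 2 = R.arc 1 ∧ R'.arc 3 = R.arc 2 := by
  obtain ⟨R₁, c₁, p₁, a₁, b₁, d₁, e₁⟩ := exists_shift1 R
  obtain ⟨R₂, c₂, p₂, a₂, b₂, d₂, e₂⟩ := exists_shift1 R₁
  obtain ⟨R₃, c₃, p₃, a₃, b₃, d₃, e₃⟩ := exists_shift1 R₂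
  have key : ∀ i : Fin 4, i + 1 + 1 + 1 = i + 3 := by decide
  refine ⟨R₃, c₃.trans (c₂.trans c₁), fun i => ?_, ?_, ?_, ?_, ?_⟩
  · rw [p₃, p₂, p₁, key]
  · rw [a₃, b₂, d₁]
  · rw [b₃, d₂, e₁]
  · rw [d₃, e₂, a₁]
  · rw [e₃, a₂, b₁]

/-- A conformal equivalence onto `R.carrier` is one onto any equal carrier, with the same boundary
values (transport of the target along an equality of sets). -/
theorem exists_conformalEquiv_of_carrier_eq {R R' : ConformalRectangle} (hc : R'.carrier = R.carrier)
    (φ : ConformalEquiv upperHalfPlaneSet R.carrier) :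
    ∃ φ' : ConformalEquiv upperHalfPlaneSet R'.carrier,
      ∀ (x p : ℂ), φ'.HasBoundaryValue x p ↔ φ.HasBoundaryValue x p := by
  obtain ⟨⟨carrier, bd, o, bdd, conn, cb, pb, ib, rb⟩, mk, sm, mm⟩ := R'
  simp only at hc
  subst hc
  exact ⟨φ, fun _ _ => Iff.rfl⟩

/-- **Cross-ratio of the re-marked tuple**: for a strictly monotone or strictly antitone `x`,
the tuple `y i = x (i + 3) = (x₃, x₀, x₁, x₂)` has `crossRatio y = 1 - crossRatio x`. -/
theorem crossRatio_shift3 {x : Fin 4 → ℝ} (hx : StrictMono x ∨ StrictAnti x) :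
    crossRatio (fun i => x (i + 3)) = 1 - crossRatio x := by
  have h01 : (0 : Fin 4) < 1 := by decide
  have h12 : (1 : Fin 4) < 2 := by decide
  have h23 : (2 : Fin 4) < 3 := by decide
  have h02 : (0 : Fin 4) < 2 := by decide
  have h13 : (1 : Fin 4) < 3 := by decide
  have hne02 : x 0 - x 2 ≠ 0 := by
    rcases hx with hx | hx
    · exact sub_ne_zero.2 (hx h02).ne
    · exact sub_ne_zero.2 (hx h02).ne'
  have hne13 : x 1 - x 3 ≠ 0 := by
    rcases hx with hx | hx
    · exact sub_ne_zero.2 (hx h13).ne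
    · exact sub_ne_zero.2 (hx h13).ne'
  have hne31 : x 3 - x 1 ≠ 0 := fun h => hne13 (by linarith)
  unfold crossRatio
  have e0 : (0 : Fin 4) + 3 = 3 := by decide
  have e1 : (1 : Fin 4) + 3 = 0 := by decide
  have e2 : (2 : Fin 4) + 3 = 1 := by decide
  have e3 : (3 : Fin 4) + 3 = 2 := by decide
  simp only [e0, e1, e2, e3]
  rw [eq_sub_iff_add_eq, div_add_div _ _ (mul_ne_zero hne31 hne02) (mul_ne_zero hne02 hne13),
    div_eq_one_iff_eq (mul_ne_zero (mul_ne_zero hne31 hne02) (mul_ne_zero hne02 hne13))]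
  ring

/-- **A uniformizing datum of the re-marked rectangle with cross-ratio `1 - η`.**  If `(φ, x)`
uniformizes `R` and `R'` is `R` re-marked three steps (`R'.carrier = R.carrier`,
`R'.pt i = R.pt (i + 3)`), then `R'` has a uniformizing datum of cross-ratio `1 - crossRatio x`
(the boundary preimages `(x₃, x₀, x₁, x₂)` of `φ` are monotone only cyclically; a real Möbius map
of `ℍₒ` renormalises them, `ConformalRectangle.exists_isUniformizing_of_cyclic`). -/
theorem exists_isUniformizing_shift3 {R R' : ConformalRectangle} (hc : R'.carrier = R.carrier)
    (hpt : ∀ i, R'.pt i = R.pt (i + 3)) {φ : ConformalEquiv upperHalfPlaneSet R.carrier}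
    {x : Fin 4 → ℝ} (hφ : R.IsUniformizing φ x) :
    ∃ (φ' : ConformalEquiv upperHalfPlaneSet R'.carrier) (x' : Fin 4 → ℝ),
      R'.IsUniformizing φ' x' ∧ crossRatio x' = 1 - crossRatio x := by
  obtain ⟨ψ, hψ⟩ := exists_conformalEquiv_of_carrier_eq hc φ
  set y : Fin 4 → ℝ := fun i => x (i + 3) with hy
  have hbv : ∀ i, ψ.HasBoundaryValue (y i) (R'.pt i) := fun i => by
    rw [hψ, hpt i]
    exact hφ.2 (i + 3)
  have e0 : (0 : Fin 4) + 3 = 3 := by decide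
  have e1 : (1 : Fin 4) + 3 = 0 := by decide
  have e2 : (2 : Fin 4) + 3 = 1 := by decide
  have e3 : (3 : Fin 4) + 3 = 2 := by decide
  have h01 : (0 : Fin 4) < 1 := by decide
  have h12 : (1 : Fin 4) < 2 := by decide
  have h23 : (2 : Fin 4) < 3 := by decide
  have hcyc : (y 1 < y 2 ∧ y 2 < y 3 ∧ y 3 < y 0) ∨ (y 0 < y 3 ∧ y 3 < y 2 ∧ y 2 < y 1) := by
    simp only [hy, e0, e1, e2, e3]
    rcases hφ.1 with hm | hm
    · exact Or.inl ⟨hm h01, hm h12, hm h23⟩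
    · exact Or.inr ⟨hm h23, hm h12, hm h01⟩
  obtain ⟨φ', x', hφ', hcr⟩ := ConformalRectangle.exists_isUniformizing_of_cyclic R' ψ y hbv hcyc
  exact ⟨φ', x', hφ', by rw [hcr, hy, crossRatio_shift3 hφ.1]⟩

/-! ### Cardy values under `SublimitsCardy` -/

open Summit.CriticalPhenomena.CardyFormulaZ2.Theses.CardyMeckeFlip

/-- **The Cardy value of the quad of `R`.**  Under `SublimitsCardy`, every subsequential limit
`μ ∈ Λ` gives the quad `rq ((Homeomorph.mulLeft₀ Complex.I Complex.I_ne_zero).trans Φ) 1 1` of `R` (for a square model `Φ`) the probability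
`F(crossRatio x)`, for every uniformizing datum `(φ, x)` of `R`. -/
theorem measureReal_crossedEvent_quadOf (hT : SublimitsCardy)
    {μ : FiniteMeasure (QuadConfig (univ : Set ℂ))} (hμ : μ ∈ subseqQuadLimits (univ : Set ℂ))
    {R : ConformalRectangle} {Φ : ℂ ≃ₜ ℂ} (h : IsSquareModel R Φ)
    {φ : ConformalEquiv upperHalfPlaneSet R.carrier} {x : Fin 4 → ℝ} (hφ : R.IsUniformizing φ x) :
    (μ : Measure (QuadConfig (univ : Set ℂ))).real
        (QuadConfig.crossedEvent (Quad.rectQuad ((Homeomorph.mulLeft₀ Complex.I Complex.I_ne_zero).trans Φ) 1 1 one_pos one_pos (fun _ => mem_univ _))) =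
      Literature.Probability.RandomPlanarGeometry.cardyFunction (crossRatio x) :=
  hT μ hμ R φ x hφ _ (carrier_quadOf h) (side_zero_quadOf h) (side_one_quadOf h)
    (side_two_quadOf h) (side_three_quadOf h)

/-- **The Cardy value of the transposed quad.**  Under `SublimitsCardy`, every `μ ∈ Λ` gives the
transposed quad `rq Φ 1 1` the probability `1 - F(crossRatio x)` (it is the quad of the
re-marked rectangle, of cross-ratio `1 - η`, and `F(1 - η) = 1 - F(η)`). -/
theorem measureReal_crossedEvent_transposeOf (hT : SublimitsCardy)
    {μ : FiniteMeasure (QuadConfig (univ : Set ℂ))} (hμ : μ ∈ subseqQuadLimits (univ : Set ℂ))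
    {R : ConformalRectangle} {Φ : ℂ ≃ₜ ℂ} (h : IsSquareModel R Φ)
    {φ : ConformalEquiv upperHalfPlaneSet R.carrier} {x : Fin 4 → ℝ} (hφ : R.IsUniformizing φ x) :
    (μ : Measure (QuadConfig (univ : Set ℂ))).real
        (QuadConfig.crossedEvent (Quad.rectQuad (Φ) 1 1 one_pos one_pos (fun _ => mem_univ _))) =
      1 - Literature.Probability.RandomPlanarGeometry.cardyFunction (crossRatio x) := by
  obtain ⟨R', hc, hpt, a0, a1, a2, a3⟩ := exists_shift3 R
  obtain ⟨φ', x', hφ', hcr⟩ := exists_isUniformizing_shift3 hc hpt hφ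
  have hval := hT μ hμ R' φ' x' hφ' (Quad.rectQuad (Φ) 1 1 one_pos one_pos (fun _ => mem_univ _))
    (by rw [carrier_transposeOf h, hc]) (by rw [side_zero_transposeOf h, a0])
    (by rw [side_one_transposeOf h, a1]) (by rw [side_two_transposeOf h, a2])
    (by rw [side_three_transposeOf h, a3])
  rw [hval, hcr]
  exact cardyFunction_one_sub_holds
    (Ioo_subset_Icc_self (ConformalRectangle.crossRatio_mem_Ioo_of_isUniformizing hφ))

/-- The same two values in `ℝ≥0∞` form: `μ ⊞_{quad of R} = ofReal (F η)`. -/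
theorem measure_crossedEvent_quadOf (hT : SublimitsCardy)
    {μ : FiniteMeasure (QuadConfig (univ : Set ℂ))} (hμ : μ ∈ subseqQuadLimits (univ : Set ℂ))
    {R : ConformalRectangle} {Φ : ℂ ≃ₜ ℂ} (h : IsSquareModel R Φ)
    {φ : ConformalEquiv upperHalfPlaneSet R.carrier} {x : Fin 4 → ℝ} (hφ : R.IsUniformizing φ x) :
    (μ : Measure (QuadConfig (univ : Set ℂ)))
        (QuadConfig.crossedEvent (Quad.rectQuad ((Homeomorph.mulLeft₀ Complex.I Complex.I_ne_zero).trans Φ) 1 1 one_pos one_pos (fun _ => mem_univ _))) =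
      ENNReal.ofReal (Literature.Probability.RandomPlanarGeometry.cardyFunction (crossRatio x)) := by
  rw [← measureReal_crossedEvent_quadOf hT hμ h hφ, ofReal_measureReal]

/-- `μ ⊞_{transposed quad of R} = ofReal (1 - F η)`. -/
theorem measure_crossedEvent_transposeOf (hT : SublimitsCardy)
    {μ : FiniteMeasure (QuadConfig (univ : Set ℂ))} (hμ : μ ∈ subseqQuadLimits (univ : Set ℂ))
    {R : ConformalRectangle} {Φ : ℂ ≃ₜ ℂ} (h : IsSquareModel R Φ)
    {φ : ConformalEquiv upperHalfPlaneSet R.carrier} {x : Fin 4 → ℝ} (hφ : R.IsUniformizing φ x) :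
    (μ : Measure (QuadConfig (univ : Set ℂ)))
        (QuadConfig.crossedEvent (Quad.rectQuad (Φ) 1 1 one_pos one_pos (fun _ => mem_univ _))) =
      ENNReal.ofReal (1 - Literature.Probability.RandomPlanarGeometry.cardyFunction (crossRatio x)) := by
  rw [← measureReal_crossedEvent_transposeOf hT hμ h hφ, ofReal_measureReal]

end Summit.CriticalPhenomena.CardyFormulaZ2.Theorems.MeckeFlipBridge

end
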